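import Mathlib.Analysis.ODE.Gronwall
import Mathlib.Analysis.Calculus.Deriv.Slope
import Mathlib.MeasureTheory.Integral.IntervalIntegral.FundThmCalculus
import Mathlib.Analysis.Normed.Lp.SmoothApprox
import Mathlib.Analysis.SpecificLimits.Basic
import Mathlib.MeasureTheory.Integral.Prod
import Mathlib.MeasureTheory.Constructions.Polish.Basic
import Mathlib.MeasureTheory.Function.LpSeminorm.Indicator
import Literature.Analysis.FluidPDE.NSHopfGalerkin
import Literature.Analysis.FluidPDE.NSGalerkinFourier
import Literature.Analysis.ODE.GlobalExistence
import Literature.Analysis.FunctionSpaces.TorusSpaceTimeFields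
import HarnessLib

/-!
# Hopf's existence theorem on `𝕋³`, first half: the Galerkin approximations exist
  (discharge of the named fact `NS.hopf_galerkin_scheme_exists`)

Trunk: FluidKinetic. This module proves `NS.hopf_galerkin_scheme_exists_holds`
(`Literature/Analysis/FluidPDE/NSHopfGalerkin`; Robinson–Rodrigo–Sadowski 2016, Thm. 4.4,
Steps 1–2; Constantin–Foias 1988, Ch. 8, (8.3)–(8.16); Hopf 1951, §§2–3) in three parts, each
with its own section documentation below:

1. **The Galerkin ODE** (`NS.exists_galerkin_solution`, `NS.galerkin_test_identity`,
   `NS.galerkin_energy_identity`): global classical solutions of the finite-dimensional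
   Fourier–Galerkin system in the real, divergence-free coefficient vectors (local Lipschitz
   field, energy identity, Grönwall a priori bound, `ODE.exists_solution_of_apriori_bound`);
2. **Smoothed forces** (`Torus.exists_smooth_realTrigPoly_approx`): every `f ∈ L²((0,T) × T^d)`
   (all `T`) is the `L²ₜₓ` limit of smooth real trigonometric polynomials with smooth
   coefficients (Mathlib's `MemLp.exist_eLpNorm_sub_le`, symmetrisation, dominated convergence
   of the Parseval tails);
3. **Assembly** (`NS.exists_isHopfGalerkinScheme`, `NS.hopf_galerkin_scheme_exists_holds`).

## References

* E. Hopf, *Über die Anfangswertaufgabe für die hydrodynamischen Grundgleichungen*, Math. Nachr.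
  4 (1951), 213–231, §§2–3.
* J. C. Robinson, J. L. Rodrigo, W. Sadowski, *The three-dimensional Navier–Stokes equations*
  (CUP 2016), §4.1, Lemma 4.1, Thm. 4.4 Steps 1–2, (4.2)–(4.8).
* P. Constantin, C. Foias, *Navier–Stokes Equations* (Chicago 1988), Ch. 8, (8.3)–(8.16), p. 43.
* G. Teschl, *Ordinary Differential Equations and Dynamical Systems* (AMS 2012), §2.4
  (continuation of solutions; via `Literature/Analysis/ODE/GlobalExistence`).
-/

/-!
# Part 1 — the Galerkin ODE of the Navier–Stokes equations on `T^d`: global solutions,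
  the tested Galerkin identity and the energy identity

Trunk: FluidKinetic. For a finite symmetric frequency set `S ⊆ ℤ^d`, viscosity `ν ≥ 0` and
continuous force coefficients `g : ℝ → (S → ℂ^d)`, the Fourier–Galerkin system
`ċ = V(g(t), c)`, `V = Torus.galerkinField` (`NSGalerkinFourier`), is an ODE in the
finite-dimensional space `S → ℂ^d`, leaving invariant the real subspace of conjugate-symmetric,
transversal ("real, divergence-free") coefficients. This file proves what Steps 1–2 of the
printed proof of Hopf's theorem assert about it (Robinson–Rodrigo–Sadowski 2016, Thm. 4.4:
Step 1, p. 74, local existence, "the right-hand side of (4.5) is continuous and locally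
Lipschitz"; Step 2, p. 75, the energy identity (4.6)–(4.7), whence "the `c_k^n` do not blow up in
finite time and hence `T_n = ∞`"; Constantin–Foias 1988, Ch. 8, (8.5)–(8.9); Temam 1977, Ch. III,
§3.2, (3.43)–(3.47); Hopf 1951, §2):

* `NS.exists_galerkin_solution` — **global existence**: for `c₀` real and divergence free there
  is `α : [0, ∞) → S → ℂ^d`, `α 0 = c₀`, staying real and divergence free, continuous, solving
  the Galerkin ODE on every `[0, T]` (local Lipschitz bound + a priori energy bound by Grönwall,
  fed into `ODE.exists_solution_of_apriori_bound`);
* `NS.galerkin_test_identity` — the **tested Galerkin equations integrated in time**: for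
  `u(t) = realTrigPoly S (α t)`, `G(t) = realTrigPoly S (g t)` and every smooth divergence-free
  `a` band-limited to `S`,
  `⟪u(t), a⟫ - ⟪u(s), a⟫ = ∫ₛᵗ ∫ (⟪u, (u·∇)a⟫ + ν⟪u, Δa⟫ + ⟪G, a⟫)` (RRS (4.5); the clause
  `IsHopfGalerkinScheme.galerkin` of `NSHopfGalerkin`);
* `NS.galerkin_energy_identity` — the **energy identity**
  `½‖u(t)‖² + ν ∫ₛᵗ ‖∇u‖² = ½‖u(s)‖² + ∫ₛᵗ ⟪G, u⟫` (RRS (4.6)–(4.7); the clause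
  `IsHopfGalerkinScheme.energy_eq`, dissipation as `Torus.eGradNormSq`);
* the remaining clauses of the scheme for such `u`: joint continuity on `[0, ∞) × T^d`,
  smoothness, (weak) divergence-freeness and band-limitation of every slice.

## Mathlib search

Mathlib (this pin) has Picard–Lindelöf and Grönwall (`le_gronwallBound_of_liminf_deriv_right_le`)
but no global-existence-from-energy statement and no Galerkin system (searched `Galerkin`,
`apriori`, `global` in `Mathlib/Analysis/ODE`: none); the continuation argument is
`Literature/Analysis/ODE/GlobalExistence`.

## References

* J. C. Robinson, J. L. Rodrigo, W. Sadowski, *The three-dimensional Navier–Stokes equations*,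
  CUP 2016, §4.1, Thm. 4.4 Steps 1–2, (4.3)–(4.8), pp. 73–75.
* P. Constantin, C. Foias, *Navier–Stokes Equations*, Chicago 1988, Ch. 8, (8.3)–(8.9).
* R. Temam, *Navier–Stokes Equations*, North-Holland 1977, Ch. III, §3.2, (3.43)–(3.47).
* E. Hopf, Math. Nachr. 4 (1951), 213–231, §2.
-/

open MeasureTheory Set Filter Topology UnitAddTorus Metric
open scoped ENNReal NNReal InnerProductSpace

noncomputable section

namespace Literature.Analysis.FluidPDE

section NS

open FunctionSpaces.Torus Torus

variable {d : Type*} [Fintype d]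

/-! ## The Galerkin vector field on `S → ℂ^d`: Lipschitz and continuity bounds -/

section Field

variable [DecidableEq d] {S : Finset (d → ℤ)}

omit [DecidableEq d] in
/-- A crude bound for the frequencies of `S`: `|k|² ≤ ∑_{k'∈S} |k'|²`. [folklore] -/
theorem freqNormSq_le_sum {k : d → ℤ} (hk : k ∈ S) : freqNormSq k ≤ ∑ k' ∈ S, freqNormSq k' :=
  Finset.single_le_sum (f := freqNormSq) (fun k' _ => freqNormSq_nonneg k') hk

omit [DecidableEq d] in
/-- **Local Lipschitz bound** of the Galerkin field, uniform in the force: on the ball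
`‖c‖ ≤ ρ` of `S → ℂ^d` (sup norm),
`‖V(g, c) - V(g, c')‖ ≤ (‖ν‖ 4π² Λ_S + 4π M_S ρ) ‖c - c'‖`, `Λ_S = ∑_{k∈S} |k|²`,
`M_S = #S ∑_{m∈S} ∑ⱼ |mⱼ|` (the field is linear plus quadratic; RRS 2016, Thm. 4.4 Step 1:
"locally Lipschitz"). [cite: RobinsonRodrigoSadowski2016, Thm. 4.4 Step 1] -/
theorem norm_galerkinRHS_sub_le (ν : ℝ) (g : ↥S → EuclideanSpace ℂ d) {ρ : ℝ}
    {c c' : ↥S → EuclideanSpace ℂ d} (hc : ‖c‖ ≤ ρ) (hc' : ‖c'‖ ≤ ρ) :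
    ‖galerkinRHS S ν g c - galerkinRHS S ν g c'‖ ≤
      (‖ν‖ * (4 * Real.pi ^ 2 * ∑ k ∈ S, freqNormSq k) +
        2 * (2 * Real.pi * (S.card * ∑ m ∈ S, ∑ j, |(m j : ℝ)|) * ρ)) * ‖c - c'‖ := by
  have hρ : 0 ≤ ρ := (norm_nonneg _).trans hc
  set Λ : ℝ := ∑ k ∈ S, freqNormSq k with hΛ
  set M : ℝ := S.card * ∑ m ∈ S, ∑ j, |(m j : ℝ)| with hM
  have hM0 : 0 ≤ M := by positivity
  have hΛ0 : 0 ≤ Λ := Finset.sum_nonneg fun k _ => freqNormSq_nonneg k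
  have hK : 0 ≤ ‖ν‖ * (4 * Real.pi ^ 2 * Λ) + 2 * (2 * Real.pi * M * ρ) := by positivity
  refine (pi_norm_le_iff_of_nonneg (by positivity)).2 fun k => ?_
  rw [Pi.sub_apply, galerkinRHS_apply, galerkinRHS_apply, galerkinField_def, galerkinField_def]
  -- coordinates of the extensions
  have hxl : ∀ l ∈ S, ‖coeffExt S c l‖ ≤ ρ := fun l _ => (norm_coeffExt_le c l).trans hc
  have hyl : ∀ l ∈ S, ‖coeffExt S c' l‖ ≤ ρ := fun l _ => (norm_coeffExt_le c' l).trans hc'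
  have hdl : ∀ l ∈ S, ‖(coeffExt S c - coeffExt S c') l‖ ≤ ‖c - c'‖ := fun l _ => by
    rw [← coeffExt_sub]; exact norm_coeffExt_le _ l
  -- the Stokes term
  have h1 : ‖-(((ν * (4 * Real.pi ^ 2 * freqNormSq (k : d → ℤ)) : ℝ) : ℂ) • coeffExt S c k) -
      -(((ν * (4 * Real.pi ^ 2 * freqNormSq (k : d → ℤ)) : ℝ) : ℂ) • coeffExt S c' k)‖ ≤
      ‖ν‖ * (4 * Real.pi ^ 2 * Λ) * ‖c - c'‖ := by
    rw [neg_sub_neg, ← smul_sub, norm_smul, Complex.norm_real, norm_mul,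
      Real.norm_of_nonneg (by have := freqNormSq_nonneg (k : d → ℤ); positivity :
        (0 : ℝ) ≤ 4 * Real.pi ^ 2 * freqNormSq (k : d → ℤ))]
    have hfk : freqNormSq (k : d → ℤ) ≤ Λ := freqNormSq_le_sum k.2
    have hcc : ‖coeffExt S c' k - coeffExt S c k‖ ≤ ‖c - c'‖ := by
      rw [norm_sub_rev]; exact hdl k k.2
    have hνΛ : 0 ≤ ‖ν‖ * (4 * Real.pi ^ 2 * Λ) := by positivity
    exact mul_le_mul (mul_le_mul_of_nonneg_left (by gcongr) (norm_nonneg ν)) hcc (norm_nonneg _) hνΛ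
  -- the projected nonlinearity
  have h2 : ‖leraySym k (coeffExt S g k - convectionCoeff S (coeffExt S c) (coeffExt S c) k) -
      leraySym k (coeffExt S g k - convectionCoeff S (coeffExt S c') (coeffExt S c') k)‖ ≤
      2 * (2 * Real.pi * M * ρ) * ‖c - c'‖ := by
    refine (norm_leraySym_sub_le _ _ _).trans ?_
    rw [sub_sub_sub_cancel_left, norm_sub_rev, convectionCoeff_self_sub_self]
    refine (norm_add_le _ _).trans ?_
    have hb1 := norm_convectionCoeff_le S (R := ‖c - c'‖) (R' := ρ) hdl hxl (k : d → ℤ)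
    have hb2 := norm_convectionCoeff_le S (R := ρ) (R' := ‖c - c'‖) hyl hdl (k : d → ℤ)
    rw [← hM] at hb1 hb2
    calc ‖convectionCoeff S (coeffExt S c - coeffExt S c') (coeffExt S c) k‖ +
        ‖convectionCoeff S (coeffExt S c') (coeffExt S c - coeffExt S c') k‖
        ≤ 2 * Real.pi * M * ‖c - c'‖ * ρ + 2 * Real.pi * M * ρ * ‖c - c'‖ := add_le_add hb1 hb2
      _ = 2 * (2 * Real.pi * M * ρ) * ‖c - c'‖ := by ring
  have heq : -(((ν * (4 * Real.pi ^ 2 * freqNormSq (k : d → ℤ)) : ℝ) : ℂ) • coeffExt S c k) +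
        leraySym k (coeffExt S g k - convectionCoeff S (coeffExt S c) (coeffExt S c) k) -
        (-(((ν * (4 * Real.pi ^ 2 * freqNormSq (k : d → ℤ)) : ℝ) : ℂ) • coeffExt S c' k) +
          leraySym k (coeffExt S g k - convectionCoeff S (coeffExt S c') (coeffExt S c') k)) =
      (-(((ν * (4 * Real.pi ^ 2 * freqNormSq (k : d → ℤ)) : ℝ) : ℂ) • coeffExt S c k) -
          -(((ν * (4 * Real.pi ^ 2 * freqNormSq (k : d → ℤ)) : ℝ) : ℂ) • coeffExt S c' k)) +
        (leraySym k (coeffExt S g k - convectionCoeff S (coeffExt S c) (coeffExt S c) k) -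
          leraySym k (coeffExt S g k - convectionCoeff S (coeffExt S c') (coeffExt S c') k)) := by
    abel
  rw [heq]
  have hK := (norm_add_le _ _).trans (add_le_add h1 h2)
  linarith [hK]

omit [DecidableEq d] in
/-- The Galerkin field is Lipschitz on every ball, with a constant independent of the force. [cite: RobinsonRodrigoSadowski2016, Thm. 4.4 Step 1] -/
theorem lipschitzOnWith_galerkinRHS (ν : ℝ) (g : ↥S → EuclideanSpace ℂ d) (ρ : ℝ) :
    LipschitzOnWith (Real.toNNReal (‖ν‖ * (4 * Real.pi ^ 2 * ∑ k ∈ S, freqNormSq k) +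
        2 * (2 * Real.pi * (S.card * ∑ m ∈ S, ∑ j, |(m j : ℝ)|) * ρ)))
      (galerkinRHS S ν g) (closedBall 0 ρ) := by
  refine LipschitzOnWith.of_dist_le_mul fun c hc c' hc' => ?_
  rw [dist_eq_norm, dist_eq_norm]
  rw [mem_closedBall, dist_zero_right] at hc hc'
  refine (norm_galerkinRHS_sub_le ν g hc hc').trans (mul_le_mul_of_nonneg_right ?_ (norm_nonneg _))
  exact Real.le_coe_toNNReal _

omit [DecidableEq d] in
/-- **Joint continuity** of the Galerkin field in the force and the state. [folklore] -/
theorem continuous_galerkinRHS (ν : ℝ) :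
    Continuous fun p : (↥S → EuclideanSpace ℂ d) × (↥S → EuclideanSpace ℂ d) =>
      galerkinRHS S ν p.1 p.2 := by
  refine continuous_pi fun k => ?_
  have h1 : ∀ l : d → ℤ, Continuous fun p : (↥S → EuclideanSpace ℂ d) ×
      (↥S → EuclideanSpace ℂ d) => coeffExt S p.1 l := by
    intro l
    by_cases hl : l ∈ S
    · simp_rw [coeffExt_of_mem _ hl]
      exact (continuous_apply _).comp continuous_fst
    · simp_rw [coeffExt_of_not_mem _ hl]
      exact continuous_const
  have h2 : ∀ l : d → ℤ, Continuous fun p : (↥S → EuclideanSpace ℂ d) ×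
      (↥S → EuclideanSpace ℂ d) => coeffExt S p.2 l := by
    intro l
    by_cases hl : l ∈ S
    · simp_rw [coeffExt_of_mem _ hl]
      exact (continuous_apply _).comp continuous_snd
    · simp_rw [coeffExt_of_not_mem _ hl]
      exact continuous_const
  exact continuous_galerkinField ν h1 h2 k

omit [DecidableEq d] in
/-- Continuity of the Galerkin field along continuous force and state curves. [folklore] -/
theorem ContinuousOn.galerkinRHS (ν : ℝ) {s : Set ℝ} {g α : ℝ → ↥S → EuclideanSpace ℂ d}
    (hg : ContinuousOn g s) (hα : ContinuousOn α s) :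
    ContinuousOn (fun t => galerkinRHS S ν (g t) (α t)) s := by
  rw [continuousOn_iff_continuous_restrict] at hg hα ⊢
  refine continuous_pi fun k => ?_
  have h1 : ∀ l : d → ℤ, Continuous fun x : s => coeffExt S (g x) l := by
    intro l
    by_cases hl : l ∈ S
    · simp_rw [coeffExt_of_mem _ hl]
      exact (continuous_apply _).comp hg
    · simp_rw [coeffExt_of_not_mem _ hl]
      exact continuous_const
  have h2 : ∀ l : d → ℤ, Continuous fun x : s => coeffExt S (α x) l := by
    intro l
    by_cases hl : l ∈ S
    · simp_rw [coeffExt_of_mem _ hl]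
      exact (continuous_apply _).comp hα
    · simp_rw [coeffExt_of_not_mem _ hl]
      exact continuous_const
  exact continuous_galerkinField ν h1 h2 k

omit [DecidableEq d] in
/-- Continuity of the Galerkin field in time for a fixed state. [folklore] -/
theorem continuous_galerkinRHS_left (ν : ℝ) {g : ℝ → ↥S → EuclideanSpace ℂ d} (hg : Continuous g)
    (c : ↥S → EuclideanSpace ℂ d) : Continuous fun t => galerkinRHS S ν (g t) c := by
  refine continuous_pi fun k => ?_
  have h1 : ∀ l : d → ℤ, Continuous fun t => coeffExt S (g t) l := by
    intro l
    by_cases hl : l ∈ S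
    · simp_rw [coeffExt_of_mem _ hl]
      exact (continuous_apply _).comp hg
    · simp_rw [coeffExt_of_not_mem _ hl]
      exact continuous_const
  exact continuous_galerkinField ν (G := fun t => coeffExt S (g t)) (C := fun _ => coeffExt S c) h1
    (fun _ => continuous_const) k

end Field

/-! ## The energy of a coefficient curve and its derivative along the Galerkin flow -/

section Energy

variable [DecidableEq d] {S : Finset (d → ℤ)}

omit [DecidableEq d] in
/-- The real inner product of `ℂ^d` (as inferred on `EuclideanSpace ℂ d`, coordinatewise over
`ℝ`) is the real part of the complex one. [folklore] -/
theorem real_inner_eq_re_inner_euclidean (v w : EuclideanSpace ℂ d) :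
    ⟪v, w⟫_ℝ = (inner ℂ v w).re := by
  simp [PiLp.inner_apply, Complex.inner, mul_comm]

omit [DecidableEq d] in
/-- Derivative of the coefficient energy `∑_k ‖β k‖²` along a differentiable curve in
`S → ℂ^d`: `d/dt ∑_k ‖β k‖² = ∑_k 2 Re ⟪β k, β' k⟫`. [folklore] -/
theorem hasDerivWithinAt_sum_norm_sq {β : ℝ → ↥S → EuclideanSpace ℂ d}
    {v : ↥S → EuclideanSpace ℂ d} {s : Set ℝ} {t : ℝ} (h : HasDerivWithinAt β v s t) :
    HasDerivWithinAt (fun τ => ∑ k, ‖β τ k‖ ^ 2) (∑ k, 2 * (inner ℂ (β t k) (v k)).re) s t := by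
  have hk : ∀ k : ↥S, HasDerivWithinAt (fun τ => β τ k) (v k) s t := fun k =>
    (ContinuousLinearMap.proj (R := ℝ) (φ := fun _ : ↥S => EuclideanSpace ℂ d) k).hasFDerivAt
      |>.comp_hasDerivWithinAt t h
  have := HasDerivWithinAt.fun_sum (u := Finset.univ) fun k _ => (hk k).norm_sq
  simp only [real_inner_eq_re_inner_euclidean] at this
  convert this using 1

omit [DecidableEq d] in
/-- The state field of a coefficient curve: `u(t) = realTrigPoly S (α t)`. [folklore] -/
theorem kineticEnergy_realTrigPoly_coeffExt (hS : ∀ k ∈ S, -k ∈ S) {c : ↥S → EuclideanSpace ℂ d}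
    (hc : IsRealCoeff c) :
    kineticEnergy (realTrigPoly S (coeffExt S c)) = 2⁻¹ * ∑ k, ‖c k‖ ^ 2 := by
  rw [kineticEnergy_realTrigPoly hS (hc.isConjSymm_coeffExt hS),
    sum_coeffExt (fun _ v => ‖v‖ ^ 2)]

/-- **The energy identity in differential form along a Galerkin solution.** If
`β' = V(g(t), β)` within `s` at `t`, with `β t` real divergence free and `g t` real, then
`d/dt ∑_k ‖β k‖² = 2 (-ν ‖∇u‖² + ∫ ⟪G, u⟫)`, `u = realTrigPoly S β̄`, `G = realTrigPoly S ḡ`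
(RRS 2016, (4.6)–(4.7); CF 1988, (8.7)). [cite: RobinsonRodrigoSadowski2016, Thm. 4.4 Step 2 (4.6)–(4.7)] -/
theorem hasDerivWithinAt_energy (ν : ℝ) (hS : ∀ k ∈ S, -k ∈ S)
    {β : ℝ → ↥S → EuclideanSpace ℂ d} {g : ↥S → EuclideanSpace ℂ d} {s : Set ℝ} {t : ℝ}
    (h : HasDerivWithinAt β (galerkinRHS S ν g (β t)) s t) (hβ : β t ∈ galerkinSubspace S)
    (hg : IsRealCoeff g) :
    HasDerivWithinAt (fun τ => ∑ k, ‖β τ k‖ ^ 2)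
      (2 * (-(ν * (eGradNormSq (realTrigPoly S (coeffExt S (β t)))).toReal) +
        ∫ x, ⟪realTrigPoly S (coeffExt S g) x, realTrigPoly S (coeffExt S (β t)) x⟫_ℝ)) s t := by
  have h1 := hasDerivWithinAt_sum_norm_sq h
  have h2 : ∑ k, 2 * (inner ℂ (β t k) (galerkinRHS S ν g (β t) k)).re =
      2 * ∑ k ∈ S, (inner ℂ (coeffExt S (β t) k)
        (galerkinField ν S (coeffExt S g) (coeffExt S (β t)) k)).re := by
    rw [Finset.mul_sum, sum_coeffExt (fun k v => 2 * (inner ℂ v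
      (galerkinField ν S (coeffExt S g) (coeffExt S (β t)) k)).re)]
    rfl
  rw [h2, sum_re_inner_galerkinField_self ν hS (hg.isConjSymm_coeffExt hS)
    (hβ.1.isConjSymm_coeffExt hS) hβ.2.isTransversal_coeffExt] at h1
  exact h1

omit [DecidableEq d] in
/-- **The energy inequality of Galerkin solutions, Grönwall form**: along a solution as in
`hasDerivWithinAt_energy` with `ν ≥ 0`, `d/dt ∑‖β k‖² ≤ ∑_k ‖g k‖² + ∑_k ‖β k‖²`
(drop the dissipation, `2⟪G, u⟫ ≤ ‖G‖² + ‖u‖²`; RRS 2016, (4.7)–(4.8)). [cite: RobinsonRodrigoSadowski2016, Thm. 4.4 Step 2 (4.7)–(4.8)] -/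
theorem energy_deriv_le (ν : ℝ) (hν : 0 ≤ ν) (hS : ∀ k ∈ S, -k ∈ S)
    {c g : ↥S → EuclideanSpace ℂ d} (hc : c ∈ galerkinSubspace S) (hg : IsRealCoeff g) :
    2 * (-(ν * (eGradNormSq (realTrigPoly S (coeffExt S c))).toReal) +
        ∫ x, ⟪realTrigPoly S (coeffExt S g) x, realTrigPoly S (coeffExt S c) x⟫_ℝ) ≤
      1 * (∑ k, ‖c k‖ ^ 2) + ∑ k, ‖g k‖ ^ 2 := by
  have hgrad : 0 ≤ ν * (eGradNormSq (realTrigPoly S (coeffExt S c))).toReal :=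
    mul_nonneg hν ENNReal.toReal_nonneg
  have hP : ∫ x, ⟪realTrigPoly S (coeffExt S g) x, realTrigPoly S (coeffExt S c) x⟫_ℝ =
      ∑ k, (inner ℂ (g k) (c k)).re := by
    rw [integral_inner_realTrigPoly_realTrigPoly hS (hg.isConjSymm_coeffExt hS)
      (hc.1.isConjSymm_coeffExt hS), ← Finset.sum_coe_sort]
    exact Finset.sum_congr rfl fun k _ => by rw [coeffExt_coe, coeffExt_coe]
  have hCS : ∀ k : ↥S, 2 * (inner ℂ (g k) (c k)).re ≤ ‖c k‖ ^ 2 + ‖g k‖ ^ 2 := fun k => by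
    have h1 : (inner ℂ (g k) (c k)).re ≤ ‖g k‖ * ‖c k‖ := re_inner_le_norm (𝕜 := ℂ) (g k) (c k)
    nlinarith [two_mul_le_add_sq ‖g k‖ ‖c k‖]
  rw [hP, one_mul, ← Finset.sum_add_distrib]
  calc 2 * (-(ν * (eGradNormSq (realTrigPoly S (coeffExt S c))).toReal) +
        ∑ k, (inner ℂ (g k) (c k)).re)
      ≤ 2 * ∑ k, (inner ℂ (g k) (c k)).re := by linarith
    _ = ∑ k, 2 * (inner ℂ (g k) (c k)).re := by rw [Finset.mul_sum]
    _ ≤ ∑ k, (‖c k‖ ^ 2 + ‖g k‖ ^ 2) := Finset.sum_le_sum fun k _ => hCS k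

/-- **A priori bound (Grönwall).** Let `β` solve the Galerkin ODE on `[0, s']`, `s' ≤ T`,
staying in the Galerkin phase space, with real force coefficients bounded by `‖g t‖ ≤ Cg` on
`[0, T]` and `ν ≥ 0`. Then `∑_k ‖β t k‖² ≤ (∑_k ‖β 0 k‖² + #S Cg²) e^T` on `[0, s']`
(the uniform bound (4.8) of RRS 2016, p. 75, here with a force, by Grönwall as in CF 1988,
(8.9)). [cite: RobinsonRodrigoSadowski2016, Thm. 4.4 Step 2 (4.8)] -/
theorem energy_apriori_bound (ν : ℝ) (hν : 0 ≤ ν) (hS : ∀ k ∈ S, -k ∈ S)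
    {g : ℝ → ↥S → EuclideanSpace ℂ d} (hgr : ∀ t, IsRealCoeff (g t)) {T Cg : ℝ}
    (hCg : ∀ t ∈ Icc 0 T, ‖g t‖ ≤ Cg) {s' : ℝ} (hs' : s' ≤ T)
    {β : ℝ → ↥S → EuclideanSpace ℂ d}
    (hβ : ∀ t ∈ Icc 0 s', HasDerivWithinAt β (galerkinRHS S ν (g t) (β t)) (Icc 0 s') t)
    (hmem : ∀ t ∈ Icc 0 s', β t ∈ galerkinSubspace S) :
    ∀ t ∈ Icc 0 s', ∑ k, ‖β t k‖ ^ 2 ≤ (∑ k, ‖β 0 k‖ ^ 2 + S.card * Cg ^ 2) * Real.exp T := by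
  intro t ht
  set ψ : ℝ → ℝ := fun τ => ∑ k, ‖β τ k‖ ^ 2 with hψ
  set ψ' : ℝ → ℝ := fun τ => 2 * (-(ν * (eGradNormSq (realTrigPoly S (coeffExt S (β τ)))).toReal) +
    ∫ x, ⟪realTrigPoly S (coeffExt S (g τ)) x, realTrigPoly S (coeffExt S (β τ)) x⟫_ℝ) with hψ'
  have hderiv : ∀ τ ∈ Icc 0 s', HasDerivWithinAt ψ (ψ' τ) (Icc 0 s') τ := fun τ hτ =>
    hasDerivWithinAt_energy ν hS (hβ τ hτ) (hmem τ hτ) (hgr τ)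
  have hcont : ContinuousOn ψ (Icc 0 s') := fun τ hτ => (hderiv τ hτ).continuousWithinAt
  -- Grönwall with `K = 1`, `ε = #S Cg²`
  have hbound : ∀ τ ∈ Ico 0 s', ψ' τ ≤ 1 * ψ τ + S.card * Cg ^ 2 := by
    intro τ hτ
    have hτT : τ ∈ Icc 0 T := ⟨hτ.1, hτ.2.le.trans hs'⟩
    refine (energy_deriv_le ν hν hS (hmem τ (Ico_subset_Icc_self hτ)) (hgr τ)).trans ?_
    have hg2 : ∑ k, ‖g τ k‖ ^ 2 ≤ S.card * Cg ^ 2 :=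
      (sum_norm_sq_le_card_mul_norm_sq (g τ)).trans (by
        have := hCg τ hτT
        have h0 : 0 ≤ ‖g τ‖ := norm_nonneg _
        gcongr)
    linarith
  have hgron := le_gronwallBound_of_liminf_deriv_right_le (f := ψ) (f' := ψ') (δ := ψ 0) (K := 1)
    (ε := S.card * Cg ^ 2) (a := 0) (b := s') hcont (fun τ hτ r hr => ?_) le_rfl hbound t ht
  · rw [sub_zero] at hgron
    refine hgron.trans ?_
    have hgb := congrFun (gronwallBound_of_K_ne_0 (δ := ψ 0) (ε := (S.card : ℝ) * Cg ^ 2)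
      one_ne_zero) t
    simp only [one_mul, div_one] at hgb
    rw [hgb]
    have hexp : Real.exp t ≤ Real.exp T := Real.exp_le_exp.2 (ht.2.trans hs')
    have h1 : 1 ≤ Real.exp t := Real.one_le_exp ht.1
    have hψ0 : 0 ≤ ψ 0 := Finset.sum_nonneg fun k _ => sq_nonneg _
    have hε : 0 ≤ (S.card : ℝ) * Cg ^ 2 := by positivity
    nlinarith
  · -- the liminf condition from the one-sided derivative
    have hmem_nhds : Icc 0 s' ∈ 𝓝[Ici τ] τ :=
      mem_nhdsWithin.2 ⟨Iio s', isOpen_Iio, hτ.2, fun z hz => ⟨hτ.1.trans hz.2, hz.1.le⟩⟩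
    exact ((hderiv τ (Ico_subset_Icc_self hτ)).mono_of_mem_nhdsWithin hmem_nhds)
      |>.liminf_right_slope_le hr

end Energy

/-! ## Global solutions of the Galerkin ODE -/

section Global

variable [DecidableEq d] {S : Finset (d → ℤ)}

/-- **Global existence for the Galerkin system** (Robinson–Rodrigo–Sadowski 2016, Thm. 4.4,
Steps 1–2, pp. 74–75; Constantin–Foias 1988, Ch. 8, (8.5)–(8.9); Temam 1977, Ch. III, §3.2;
Hopf 1951, §2).
Let `S` be a finite symmetric frequency set, `ν ≥ 0`, `g : ℝ → (S → ℂ^d)` continuous with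
`g t` real for all `t`, and `c₀` real and divergence free. Then the Galerkin ODE
`α' = V(g(t), α)` has a solution `α : ℝ → (S → ℂ^d)` with `α 0 = c₀`, taking values in the
Galerkin phase space, continuous on `[0, ∞)`, and solving the equation on every `[0, T]`
(one-sided derivatives at the endpoints). Proof: `ODE.exists_solution_of_apriori_bound` in the
complete space `galerkinSubspace S`, with the local Lipschitz bound
`lipschitzOnWith_galerkinRHS` and the a priori energy bound `energy_apriori_bound`.
[cite: RobinsonRodrigoSadowski2016, Thm. 4.4 Steps 1–2] -/
theorem exists_galerkin_solution (ν : ℝ) (hν : 0 ≤ ν) (hS : ∀ k ∈ S, -k ∈ S)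
    {g : ℝ → ↥S → EuclideanSpace ℂ d} (hg : Continuous g) (hgr : ∀ t, IsRealCoeff (g t))
    {c₀ : ↥S → EuclideanSpace ℂ d} (hc₀ : c₀ ∈ galerkinSubspace S) :
    ∃ α : ℝ → ↥S → EuclideanSpace ℂ d, α 0 = c₀ ∧ (∀ t, α t ∈ galerkinSubspace S) ∧
      ContinuousOn α (Ici 0) ∧
      ∀ T, ∀ t ∈ Icc 0 T, HasDerivWithinAt α (galerkinRHS S ν (g t) (α t)) (Icc 0 T) t := by
  set Y := galerkinSubspace S with hY
  -- the vector field on the phase space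
  set V : ℝ → Y → Y := fun t c => ⟨galerkinRHS S ν (g t) c, galerkinRHS_mem ν hS (hgr t) c.2⟩
    with hV
  have hVcoe : ∀ t (c : Y), ((V t c : Y) : ↥S → EuclideanSpace ℂ d) = galerkinRHS S ν (g t) c :=
    fun t c => rfl
  -- Lipschitz on balls, uniformly in time
  have hlip : ∀ T ρ : ℝ, ∃ K : ℝ≥0, ∀ t ∈ Icc 0 T, LipschitzOnWith K (V t) (closedBall 0 ρ) := by
    intro T ρ
    refine ⟨Real.toNNReal (‖ν‖ * (4 * Real.pi ^ 2 * ∑ k ∈ S, freqNormSq k) +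
        2 * (2 * Real.pi * (S.card * ∑ m ∈ S, ∑ j, |(m j : ℝ)|) * ρ)), fun t _ => ?_⟩
    refine LipschitzOnWith.of_dist_le_mul fun c hc c' hc' => ?_
    rw [mem_closedBall, dist_zero_right] at hc hc'
    rw [Subtype.dist_eq, dist_eq_norm, dist_eq_norm, hVcoe, hVcoe]
    have h := norm_galerkinRHS_sub_le ν (g t) (ρ := ρ) (c := (c : ↥S → EuclideanSpace ℂ d))
      (c' := (c' : ↥S → EuclideanSpace ℂ d)) (by simpa using hc) (by simpa using hc')
    refine h.trans (mul_le_mul_of_nonneg_right (Real.le_coe_toNNReal _) (norm_nonneg _))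
  -- continuity in time
  have hcont : ∀ c : Y, ContinuousOn (V · c) (Ici 0) := by
    intro c
    refine Continuous.continuousOn ?_
    exact (continuous_galerkinRHS_left ν hg (c : ↥S → EuclideanSpace ℂ d)).subtype_mk _
  -- a priori bound
  have hapriori : ∀ T : ℝ, 0 ≤ T → ∃ R : ℝ, ‖(⟨c₀, hc₀⟩ : Y)‖ ≤ R ∧
      ∀ s ∈ Icc 0 T, ∀ α : ℝ → Y, α 0 = ⟨c₀, hc₀⟩ →
        (∀ t ∈ Icc 0 s, HasDerivWithinAt α (V t (α t)) (Icc 0 s) t) →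
        ∀ t ∈ Icc 0 s, ‖α t‖ ≤ R := by
    intro T hT
    obtain ⟨Cg, hCg⟩ := isCompact_Icc.exists_bound_of_continuousOn (hg.continuousOn (s := Icc 0 T))
    set R : ℝ := Real.sqrt ((∑ k, ‖c₀ k‖ ^ 2 + S.card * Cg ^ 2) * Real.exp T) with hR
    have hE0 : ∑ k, ‖c₀ k‖ ^ 2 ≤ (∑ k, ‖c₀ k‖ ^ 2 + S.card * Cg ^ 2) * Real.exp T := by
      have h1 : 1 ≤ Real.exp T := Real.one_le_exp hT
      have hε : 0 ≤ (S.card : ℝ) * Cg ^ 2 := by positivity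
      have hψ0 : 0 ≤ ∑ k, ‖c₀ k‖ ^ 2 := Finset.sum_nonneg fun k _ => sq_nonneg _
      nlinarith
    refine ⟨R, ?_, ?_⟩
    · change ‖c₀‖ ≤ R
      exact (norm_le_sqrt_sum_norm_sq c₀).trans (Real.sqrt_le_sqrt hE0)
    · intro s hs α hα0 hα t ht
      -- transport to `S → ℂ^d`
      set β : ℝ → ↥S → EuclideanSpace ℂ d := fun τ => (α τ : ↥S → EuclideanSpace ℂ d) with hβ
      have hβ' : ∀ τ ∈ Icc 0 s, HasDerivWithinAt β (galerkinRHS S ν (g τ) (β τ)) (Icc 0 s) τ := by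
        intro τ hτ
        exact Y.subtypeL.hasFDerivAt.comp_hasDerivWithinAt τ (hα τ hτ)
      have hmem : ∀ τ ∈ Icc 0 s, β τ ∈ galerkinSubspace S := fun τ _ => (α τ).2
      have hb := energy_apriori_bound ν hν hS hgr hCg hs.2 hβ' hmem t ht
      have hβ0 : β 0 = c₀ := by simp [hβ, hα0]
      rw [hβ0] at hb
      change ‖β t‖ ≤ R
      exact (norm_le_sqrt_sum_norm_sq (β t)).trans (Real.sqrt_le_sqrt hb)
  obtain ⟨α, hα0, hα⟩ := ODE.exists_solution_of_apriori_bound hlip hcont hapriori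
  refine ⟨fun t => (α t : ↥S → EuclideanSpace ℂ d), by simp [hα0], fun t => (α t).2, ?_, ?_⟩
  · intro t ht
    have hc := IsIntegralCurveOn.continuousOn (hα (t + 1)) t ⟨ht, by linarith⟩
    have hmem : Icc 0 (t + 1) ∈ 𝓝[Ici 0] t :=
      Filter.mem_of_superset (inter_mem_nhdsWithin (Ici (0 : ℝ)) (Iio_mem_nhds (by linarith)))
        fun s hs => ⟨hs.1, hs.2.le⟩
    exact (continuous_subtype_val.continuousAt.comp_continuousWithinAt hc).mono_of_mem_nhdsWithin
      hmem
  · intro T t ht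
    exact Y.subtypeL.hasFDerivAt.comp_hasDerivWithinAt t (hα T t ht)

end Global

/-! ## The dictionary: from coefficient solutions to the clauses of the Galerkin scheme -/

section Dictionary

variable [DecidableEq d] {S : Finset (d → ℤ)}

/-- **The tested Galerkin equations, integrated in time** (Robinson–Rodrigo–Sadowski 2016,
(4.2)/(4.5) paired with a Galerkin mode; Constantin–Foias 1988, (8.5)). Let `α` solve the
Galerkin ODE on every `[0, T]` in the Galerkin phase space, with continuous real force
coefficients `g`, and put `u(t) = realTrigPoly S (α t)`, `G(t) = realTrigPoly S (g t)`. Then for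
every smooth divergence-free `a` band-limited to `S` and `0 ≤ s ≤ t`,
`∫⟪u t, a⟫ - ∫⟪u s, a⟫ = ∫ₛᵗ ∫ (⟪u, (u·∇)a⟫ + ν ⟪u, Δa⟫ + ⟪G, a⟫)`. [cite: RobinsonRodrigoSadowski2016, Thm. 4.4 Step 1 (4.5)] -/
theorem galerkin_test_identity (ν : ℝ) (hS : ∀ k ∈ S, -k ∈ S)
    {g : ℝ → ↥S → EuclideanSpace ℂ d} (hg : Continuous g) (hgr : ∀ t, IsRealCoeff (g t))
    {α : ℝ → ↥S → EuclideanSpace ℂ d} (hmem : ∀ t, α t ∈ galerkinSubspace S)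
    (hα : ∀ T, ∀ t ∈ Icc 0 T, HasDerivWithinAt α (galerkinRHS S ν (g t) (α t)) (Icc 0 T) t)
    {a : UnitAddTorus d → EuclideanSpace ℝ d} (ha : IsSmooth a) (hdiv : FunctionSpaces.Torus.IsDivFree a)
    (hband : ∀ k ∉ S, mFourierCoeff (FunctionSpaces.EuclideanSpace.complexify ∘ a) k = 0)
    {s t : ℝ} (hs : 0 ≤ s) (hst : s ≤ t) :
    (∫ x, ⟪realTrigPoly S (coeffExt S (α t)) x, a x⟫_ℝ) -
        ∫ x, ⟪realTrigPoly S (coeffExt S (α s)) x, a x⟫_ℝ =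
      ∫ τ in s..t, ∫ x, (⟪realTrigPoly S (coeffExt S (α τ)) x,
          FunctionSpaces.Torus.convect (realTrigPoly S (coeffExt S (α τ))) a x⟫_ℝ +
        ν * ⟪realTrigPoly S (coeffExt S (α τ)) x, laplacian a x⟫_ℝ +
        ⟪realTrigPoly S (coeffExt S (g τ)) x, a x⟫_ℝ) := by
  set â : (d → ℤ) → EuclideanSpace ℂ d := fun k => mFourierCoeff (FunctionSpaces.EuclideanSpace.complexify ∘ a) k
    with hâ_def
  -- the pairing on the Fourier side
  set φ : ℝ → ℝ := fun τ => ∑ k : ↥S, (inner ℂ (â k) (α τ k)).re with hφ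
  have hφ_eq : ∀ τ, ∫ x, ⟪realTrigPoly S (coeffExt S (α τ)) x, a x⟫_ℝ = φ τ := by
    intro τ
    rw [integral_inner_realTrigPoly_left hS ((hmem τ).1.isConjSymm_coeffExt hS) (ha.memLp 2),
      sum_coeffExt (fun k v => (inner ℂ v (mFourierCoeff (FunctionSpaces.EuclideanSpace.complexify ∘ a) k)).re)]
    exact Finset.sum_congr rfl fun k _ => inner_re_symm (𝕜 := ℂ) _ _
  -- its derivative on the Fourier side
  set D : ℝ → ℝ := fun τ => ∑ k : ↥S, (inner ℂ (â k) (galerkinRHS S ν (g τ) (α τ) k)).re with hD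
  have hD_eq : ∀ τ, D τ = ∫ x, (⟪realTrigPoly S (coeffExt S (α τ)) x,
      FunctionSpaces.Torus.convect (realTrigPoly S (coeffExt S (α τ))) a x⟫_ℝ +
      ν * ⟪realTrigPoly S (coeffExt S (α τ)) x, laplacian a x⟫_ℝ +
      ⟪realTrigPoly S (coeffExt S (g τ)) x, a x⟫_ℝ) := by
    intro τ
    rw [← sum_re_inner_galerkinField_test ν hS ((hgr τ).isConjSymm_coeffExt hS)
      ((hmem τ).1.isConjSymm_coeffExt hS) (hmem τ).2.isTransversal_coeffExt ha hdiv hband,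
      ← Finset.sum_coe_sort]
    exact Finset.sum_congr rfl fun k _ => inner_re_symm (𝕜 := ℂ) _ _
  -- the real-linear functionals `c ↦ Re ⟪w, c k⟫`
  have hderivφ : ∀ T, ∀ τ ∈ Icc 0 T, HasDerivWithinAt φ (D τ) (Icc 0 T) τ := by
    intro T τ hτ
    have hk : ∀ k : ↥S, HasDerivWithinAt (fun τ => (inner ℂ (â k) (α τ k)).re)
        ((inner ℂ (â k) (galerkinRHS S ν (g τ) (α τ) k)).re) (Icc 0 T) τ := by
      intro k
      set L : EuclideanSpace ℂ d →L[ℝ] ℝ :=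
        Complex.reCLM.comp ((innerSL ℂ (â (k : d → ℤ))).restrictScalars ℝ) with hL
      have hLapply : ∀ v, L v = (inner ℂ (â k) v).re := fun v => rfl
      have h1 : HasDerivWithinAt (fun τ => α τ k) (galerkinRHS S ν (g τ) (α τ) k) (Icc 0 T) τ :=
        (ContinuousLinearMap.proj (R := ℝ) (φ := fun _ : ↥S => EuclideanSpace ℂ d) k).hasFDerivAt
          |>.comp_hasDerivWithinAt τ (hα T τ hτ)
      have h2 := L.hasFDerivAt.comp_hasDerivWithinAt τ h1
      simpa only [Function.comp_def, hLapply] using h2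
    exact HasDerivWithinAt.fun_sum (u := Finset.univ) fun k _ => hk k
  -- continuity of `D` on `[0, t]`
  have hDcont : ContinuousOn D (Icc 0 t) := by
    have hα_cont : ContinuousOn α (Icc 0 t) := fun τ hτ => (hα t τ hτ).continuousWithinAt
    have hR := ContinuousOn.galerkinRHS ν (hg.continuousOn (s := Icc 0 t)) hα_cont
    refine continuousOn_finsetSum _ fun k _ => ?_
    refine (Complex.continuous_re.comp_continuousOn ?_)
    exact (continuousOn_const.inner ((continuous_apply k).comp_continuousOn hR))
  -- fundamental theorem of calculus on `[s, t]`
  have hFTC : ∫ τ in s..t, D τ = φ t - φ s := by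
    refine intervalIntegral.integral_eq_sub_of_hasDeriv_right_of_le hst ?_ ?_ ?_
    · exact fun τ hτ => ((hderivφ t τ ⟨hs.trans hτ.1, hτ.2⟩).continuousWithinAt).mono
        (Icc_subset_Icc hs le_rfl)
    · intro τ hτ
      have h := hderivφ t τ ⟨hs.trans hτ.1.le, hτ.2.le⟩
      exact (h.hasDerivAt (Icc_mem_nhds (hs.trans_lt hτ.1) hτ.2)).hasDerivWithinAt
    · exact (hDcont.mono (by rw [uIcc_of_le hst]; exact Icc_subset_Icc hs le_rfl)).intervalIntegrable
  rw [hφ_eq, hφ_eq, ← hFTC]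
  exact intervalIntegral.integral_congr fun τ _ => (hD_eq τ)

omit [DecidableEq d] in
/-- The dissipation of a Galerkin state as a real number:
`(eGradNormSq u).toReal = 4π² ∑_k |k|² ‖α k‖²`, continuous along continuous curves. [folklore] -/
theorem toReal_eGradNormSq_coeffExt (hS : ∀ k ∈ S, -k ∈ S) {c : ↥S → EuclideanSpace ℂ d}
    (hc : IsRealCoeff c) :
    (eGradNormSq (realTrigPoly S (coeffExt S c))).toReal =
      4 * Real.pi ^ 2 * ∑ k : ↥S, freqNormSq (k : d → ℤ) * ‖c k‖ ^ 2 := by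
  rw [toReal_eGradNormSq_realTrigPoly hS (hc.isConjSymm_coeffExt hS),
    sum_coeffExt (fun k v => freqNormSq k * ‖v‖ ^ 2)]

omit [DecidableEq d] in
/-- The dissipation of a Galerkin state in `ℝ≥0∞`: `eGradNormSq u = ofReal (4π² ∑_k |k|² ‖α k‖²)`. [folklore] -/
theorem eGradNormSq_coeffExt (hS : ∀ k ∈ S, -k ∈ S) {c : ↥S → EuclideanSpace ℂ d}
    (hc : IsRealCoeff c) :
    eGradNormSq (realTrigPoly S (coeffExt S c)) =
      ENNReal.ofReal (4 * Real.pi ^ 2 * ∑ k : ↥S, freqNormSq (k : d → ℤ) * ‖c k‖ ^ 2) := by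
  rw [eGradNormSq_realTrigPoly hS (hc.isConjSymm_coeffExt hS),
    sum_coeffExt (fun k v => freqNormSq k * ‖v‖ ^ 2)]

/-- **The energy identity of Galerkin solutions** (Robinson–Rodrigo–Sadowski 2016, (4.6)–(4.7),
(4.19); Constantin–Foias 1988, (8.7)–(8.9)). With `α`, `g`, `u`, `G` as in
`galerkin_test_identity` and `0 ≤ s ≤ t`,
`½‖u t‖² + ν ∫ₛᵗ ‖∇u‖² = ½‖u s‖² + ∫ₛᵗ ∫ ⟪G, u⟫`, the dissipation written as
`(∫⁻_{(s,t)} eGradNormSq (u τ)).toReal`. [cite: RobinsonRodrigoSadowski2016, Thm. 4.4 Step 2 (4.6)–(4.7)] -/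
theorem galerkin_energy_identity (ν : ℝ) (hS : ∀ k ∈ S, -k ∈ S)
    {g : ℝ → ↥S → EuclideanSpace ℂ d} (hg : Continuous g) (hgr : ∀ t, IsRealCoeff (g t))
    {α : ℝ → ↥S → EuclideanSpace ℂ d} (hmem : ∀ t, α t ∈ galerkinSubspace S)
    (hα : ∀ T, ∀ t ∈ Icc 0 T, HasDerivWithinAt α (galerkinRHS S ν (g t) (α t)) (Icc 0 T) t)
    {s t : ℝ} (hs : 0 ≤ s) (hst : s ≤ t) :
    kineticEnergy (realTrigPoly S (coeffExt S (α t))) +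
        ν * (∫⁻ τ in Ioo s t, eGradNormSq (realTrigPoly S (coeffExt S (α τ)))).toReal =
      kineticEnergy (realTrigPoly S (coeffExt S (α s))) +
        ∫ τ in s..t, ∫ x, ⟪realTrigPoly S (coeffExt S (g τ)) x,
          realTrigPoly S (coeffExt S (α τ)) x⟫_ℝ := by
  -- name the energy, the dissipation and the power
  obtain ⟨ψ, hψ⟩ : ∃ ψ : ℝ → ℝ, ψ = fun τ => ∑ k, ‖α τ k‖ ^ 2 := ⟨_, rfl⟩
  obtain ⟨Egrad, hEgrad⟩ : ∃ E : ℝ → ℝ,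
      E = fun τ => (eGradNormSq (realTrigPoly S (coeffExt S (α τ)))).toReal := ⟨_, rfl⟩
  obtain ⟨P, hP⟩ : ∃ P : ℝ → ℝ, P = fun τ => ∫ x, ⟪realTrigPoly S (coeffExt S (g τ)) x,
      realTrigPoly S (coeffExt S (α τ)) x⟫_ℝ := ⟨_, rfl⟩
  have hderiv : ∀ T, ∀ τ ∈ Icc 0 T, HasDerivWithinAt ψ (2 * (-(ν * Egrad τ) + P τ)) (Icc 0 T) τ := by
    intro T τ hτ
    subst hψ hEgrad hP
    exact hasDerivWithinAt_energy ν hS (hα T τ hτ) (hmem τ) (hgr τ)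
  have hα_cont : ContinuousOn α (Icc 0 t) := fun τ hτ => (hα t τ hτ).continuousWithinAt
  -- continuity of the dissipation and of the power on `[0, t]` (Fourier side)
  have hEgrad_eq : ∀ τ, Egrad τ = 4 * Real.pi ^ 2 * ∑ k : ↥S, freqNormSq (k : d → ℤ) * ‖α τ k‖ ^ 2 := by
    intro τ; subst hEgrad; exact toReal_eGradNormSq_coeffExt hS (hmem τ).1
  have hEgrad_cont : ContinuousOn Egrad (Icc 0 t) := by
    rw [funext hEgrad_eq]
    refine continuousOn_const.mul (continuousOn_finsetSum _ fun k _ => ?_)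
    exact continuousOn_const.mul (((continuous_apply k).comp_continuousOn hα_cont).norm.pow 2)
  have hP_eq : ∀ τ, P τ = ∑ k : ↥S, (inner ℂ (g τ k) (α τ k)).re := by
    intro τ
    subst hP
    show ∫ x, ⟪realTrigPoly S (coeffExt S (g τ)) x, realTrigPoly S (coeffExt S (α τ)) x⟫_ℝ = _
    rw [integral_inner_realTrigPoly_realTrigPoly hS ((hgr τ).isConjSymm_coeffExt hS)
      ((hmem τ).1.isConjSymm_coeffExt hS), ← Finset.sum_coe_sort]
    exact Finset.sum_congr rfl fun k _ => by rw [coeffExt_coe, coeffExt_coe]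
  have hP_cont : ContinuousOn P (Icc 0 t) := by
    rw [funext hP_eq]
    refine continuousOn_finsetSum _ fun k _ => Complex.continuous_re.comp_continuousOn ?_
    exact ((continuous_apply k).comp_continuousOn (hg.continuousOn (s := Icc 0 t))).inner
      ((continuous_apply k).comp_continuousOn hα_cont)
  have hsub : Icc s t ⊆ Icc 0 t := Icc_subset_Icc hs le_rfl
  have hEgrad_int : IntervalIntegrable Egrad volume s t :=
    (hEgrad_cont.mono (by rw [uIcc_of_le hst]; exact hsub)).intervalIntegrable
  have hP_int : IntervalIntegrable P volume s t :=
    (hP_cont.mono (by rw [uIcc_of_le hst]; exact hsub)).intervalIntegrable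
  have hnegE_int : IntervalIntegrable (fun τ => -(ν * Egrad τ)) volume s t :=
    (hEgrad_int.const_mul ν).neg
  -- FTC
  have hFTC : ∫ τ in s..t, 2 * (-(ν * Egrad τ) + P τ) = ψ t - ψ s := by
    refine intervalIntegral.integral_eq_sub_of_hasDeriv_right_of_le hst ?_ ?_ ?_
    · exact fun τ hτ => ((hderiv t τ ⟨hs.trans hτ.1, hτ.2⟩).continuousWithinAt).mono hsub
    · intro τ hτ
      have h := hderiv t τ ⟨hs.trans hτ.1.le, hτ.2.le⟩
      exact (h.hasDerivAt (Icc_mem_nhds (hs.trans_lt hτ.1) hτ.2)).hasDerivWithinAt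
    · exact (hnegE_int.add hP_int).const_mul 2
  have hsplit : ∫ τ in s..t, 2 * (-(ν * Egrad τ) + P τ) =
      2 * (-(ν * ∫ τ in s..t, Egrad τ) + ∫ τ in s..t, P τ) := by
    rw [intervalIntegral.integral_const_mul, intervalIntegral.integral_add hnegE_int hP_int,
      intervalIntegral.integral_neg, intervalIntegral.integral_const_mul]
  -- the dissipation as a `lintegral`
  have hlint : (∫⁻ τ in Ioo s t, eGradNormSq (realTrigPoly S (coeffExt S (α τ)))).toReal =
      ∫ τ in s..t, Egrad τ := by
    have heq : ∀ τ, eGradNormSq (realTrigPoly S (coeffExt S (α τ))) = ENNReal.ofReal (Egrad τ) := by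
      intro τ
      rw [hEgrad_eq, eGradNormSq_coeffExt hS (hmem τ).1]
    simp_rw [heq]
    have hint : IntegrableOn Egrad (Ioo s t) volume :=
      ((hEgrad_cont.mono hsub).integrableOn_compact isCompact_Icc).mono_set Ioo_subset_Icc_self
    have hnn' : ∀ τ, 0 ≤ Egrad τ := fun τ => by
      rw [hEgrad_eq]
      exact mul_nonneg (by positivity) (Finset.sum_nonneg fun k _ =>
        mul_nonneg (freqNormSq_nonneg _) (sq_nonneg _))
    have hnn : 0 ≤ᵐ[volume.restrict (Ioo s t)] Egrad := ae_of_all _ hnn'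
    rw [← ofReal_integral_eq_lintegral_ofReal hint hnn, ENNReal.toReal_ofReal
      (integral_nonneg hnn'), intervalIntegral.integral_of_le hst, integral_Ioc_eq_integral_Ioo]
  -- assemble
  have hEt : kineticEnergy (realTrigPoly S (coeffExt S (α t))) = 2⁻¹ * ψ t := by
    rw [hψ]; exact kineticEnergy_realTrigPoly_coeffExt hS (hmem t).1
  have hEs : kineticEnergy (realTrigPoly S (coeffExt S (α s))) = 2⁻¹ * ψ s := by
    rw [hψ]; exact kineticEnergy_realTrigPoly_coeffExt hS (hmem s).1
  have hPint_eq : ∫ τ in s..t, ∫ x, ⟪realTrigPoly S (coeffExt S (g τ)) x,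
      realTrigPoly S (coeffExt S (α τ)) x⟫_ℝ = ∫ τ in s..t, P τ := by rw [hP]
  rw [hEt, hEs, hlint, hPint_eq]
  rw [hsplit] at hFTC
  linarith

omit [DecidableEq d] in
/-- **Joint continuity** of `(t, x) ↦ u(t, x) = realTrigPoly S (α t) x` on `[0, ∞) × T^d`
(space–time lift) for `α` continuous on `[0, ∞)`. [folklore] -/
theorem continuousOn_stLift_realTrigPoly {α : ℝ → ↥S → EuclideanSpace ℂ d}
    (hα : ContinuousOn α (Ici 0)) :
    ContinuousOn (stLift fun t => realTrigPoly S (coeffExt S (α t))) (Ici 0 ×ˢ univ) := by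
  have h : stLift (fun t => realTrigPoly S (coeffExt S (α t))) = fun p : ℝ × EuclideanSpace ℝ d =>
      FunctionSpaces.EuclideanSpace.realPart (∑ k ∈ S, mFourier k (proj p.2) • coeffExt S (α p.1) k) := by
    funext p
    rw [stLift_apply, realTrigPoly_apply, trigPoly_apply]
  rw [h]
  refine FunctionSpaces.EuclideanSpace.realPart.continuous.comp_continuousOn ?_
  refine continuousOn_finsetSum _ fun k hk => ?_
  have hm : Continuous fun p : ℝ × EuclideanSpace ℝ d => mFourier k (proj p.2) :=
    (mFourier k).continuous.comp (continuous_proj.comp continuous_snd)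
  have hc : ContinuousOn (fun p : ℝ × EuclideanSpace ℝ d => coeffExt S (α p.1) k)
      (Ici 0 ×ˢ univ) := by
    simp_rw [coeffExt_of_mem _ hk]
    exact ((continuous_apply _).comp_continuousOn hα).comp continuous_fst.continuousOn
      fun p hp => hp.1
  exact hm.continuousOn.smul hc

/-- Slices of a Galerkin state are smooth, divergence free, weakly divergence free and
band-limited to `S`. [folklore] -/
theorem galerkin_slice_props (hS : ∀ k ∈ S, -k ∈ S) {c : ↥S → EuclideanSpace ℂ d}
    (hc : c ∈ galerkinSubspace S) :
    IsSmooth (realTrigPoly S (coeffExt S c)) ∧ FunctionSpaces.Torus.IsDivFree (realTrigPoly S (coeffExt S c)) ∧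
      FunctionSpaces.Torus.IsWeaklyDivFree (realTrigPoly S (coeffExt S c)) ∧
      ∀ k ∉ S, mFourierCoeff (FunctionSpaces.EuclideanSpace.complexify ∘ realTrigPoly S (coeffExt S c)) k = 0 := by
  have h1 : IsSmooth (realTrigPoly S (coeffExt S c)) := isSmooth_realTrigPoly S _
  have h2 : FunctionSpaces.Torus.IsDivFree (realTrigPoly S (coeffExt S c)) :=
    isDivFree_realTrigPoly hc.2.isTransversal_coeffExt
  exact ⟨h1, h2, h2.isWeaklyDivFree_holds h1, fun k hk =>
    mFourierCoeff_realTrigPoly_eq_zero hS (hc.1.isConjSymm_coeffExt hS) hk⟩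

end Dictionary

end NS

end Literature.Analysis.FluidPDE

/-!
# Part 2 — approximation of `L²ₜL²ₓ` fields on `(0,T) × T^d` by smooth-in-time trigonometric polynomials

Trunk: FluidKinetic / function spaces on the flat torus. The Galerkin scheme for the forced
Navier–Stokes equations (`NS.IsHopfGalerkinScheme`, `Literature/Analysis/FluidPDE/NSHopfGalerkin`)
drives the `n`-th finite-dimensional system by a *smoothed* force `F n` with `F n → f` in
`L²((0, T) × T^d)` for every `T` (Constantin–Foias 1988, Ch. 8, p. 43: the Galerkin system is
solved for continuous-in-time forces; Robinson–Rodrigo–Sadowski 2016, Thm. 4.4 with `f = 0`;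
the reduction of a general `f ∈ L²ₜL²ₓ` to this case is the standard density/mollification
step). This file proves that reduction on the Fourier side, in the concrete form consumed by
the Galerkin ODE (`NSGalerkinODE`): the approximants are real vector trigonometric polynomials
`realTrigPoly (freqBall n) (g n t)` whose coefficient vectors `g n : ℝ → (freqBall n → ℂ^d)`
are smooth in time and real (conjugate symmetric).

## Contents (all proved)

* `Torus.exists_smooth_realTrigPoly_approx` — for `f : ℝ → T^d → ℝ^d` space–time measurable
  with `∫₀ᵀ ∫ ‖f‖² < ⊤` for all `T`, there are smooth real coefficient curves `g n` with
  `∫₀ᵀ ∫ ‖realTrigPoly (freqBall n) (g n t) - f t‖² → 0` for every `T > 0`.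
  Proof: slice-wise Parseval splits the error into the modes `|k| ≤ n`, where `t ↦ f̂(t, k)`
  is approximated in `L²(0, n)` by smooth curves (Mathlib's
  `MeasureTheory.MemLp.exist_eLpNorm_sub_le`, density of `C_c^∞` in `L²(ℝ)`), then
  symmetrised to keep the coefficients real, and the tail `|k| > n`, which tends to zero by
  dominated convergence in `t` of the Parseval tails (Grafakos 2014, Prop. 3.2.7;
  RRS 2016, Lemma 4.1 and p. 74).
* the slice-wise Parseval identity for the error of a real trigonometric polynomial
  (`Torus.lintegral_enorm_sq_realTrigPoly_sub`); the measurability and slice lemmas it rests on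
  (a.e. slice of an `L²ₜL²ₓ` field is in `L²(T^d)`, `Torus.ae_memLp_slice`; time-measurability
  of the spatial Fourier coefficients, `Torus.aestronglyMeasurable_mFourierCoeff_stSlice`) live in
  `TorusSpaceTimeFields`.

## Mathlib search

Mathlib (this pin) has the density of smooth compactly supported functions in `Lp(ℝⁿ)`
(`MeasureTheory.MemLp.exist_eLpNorm_sub_le`, 2025), Fubini-type measurability
(`AEStronglyMeasurable.integral_prod_right'`, `.prodMk_left`), dominated convergence for
`lintegral`, and tails of `ℝ≥0∞`-series (`ENNReal.tendsto_tsum_compl_atTop_zero`); nothing on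
`L²ₜL²ₓ` on the torus (searched `UnitAddTorus` in `MeasureTheory`: none). All used, none
duplicated.

## References

* P. Constantin, C. Foias, *Navier–Stokes Equations*, Chicago 1988, Ch. 8, p. 43 and (8.3).
* J. C. Robinson, J. L. Rodrigo, W. Sadowski, *The three-dimensional Navier–Stokes equations*,
  CUP 2016, Lemma 4.1 and p. 74, Thm. 4.4 (pp. 73–77).
* L. Grafakos, *Classical Fourier Analysis*, 3rd ed., GTM 249 (2014), Prop. 3.2.7.
-/

open MeasureTheory Set Filter Topology UnitAddTorus Function
open scoped ENNReal NNReal InnerProductSpace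

namespace Literature.Analysis.FluidPDE

namespace Torus

variable {d : Type*} [Fintype d]

/-! ## Slices of `L²ₜL²ₓ` fields -/

section Slices

variable {f : ℝ → UnitAddTorus d → EuclideanSpace ℝ d} {T : ℝ}

/-- **Slice-wise Parseval for the error of a real trigonometric polynomial.** For `u ∈ L²(T^d)`,
a finite symmetric `S`, and a real coefficient vector `c` on `S`,
`∫ ‖realTrigPoly S c - u‖² = ∑_{k∈S} ‖c k - û k‖² + ∑_{k∉S} ‖û k‖²`. [cite: Grafakos2014, Prop. 3.2.7] -/
theorem lintegral_enorm_sq_realTrigPoly_sub {S : Finset (d → ℤ)} (hS : ∀ k ∈ S, -k ∈ S)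
    {c : ↥S → EuclideanSpace ℂ d} (hc : FunctionSpaces.Torus.IsRealCoeff c) {u : UnitAddTorus d → EuclideanSpace ℝ d}
    (hu : MemLp u 2 volume) :
    ∫⁻ x, ‖FunctionSpaces.Torus.realTrigPoly S (FunctionSpaces.Torus.coeffExt S c) x - u x‖ₑ ^ 2 =
      (∑ k : ↥S, ‖c k - mFourierCoeff (FunctionSpaces.EuclideanSpace.complexify ∘ u) k‖ₑ ^ 2) +
        ∑' k : ↥((S : Set (d → ℤ))ᶜ), ‖mFourierCoeff (FunctionSpaces.EuclideanSpace.complexify ∘ u) k‖ₑ ^ 2 := by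
  have hP : MemLp (FunctionSpaces.Torus.realTrigPoly S (FunctionSpaces.Torus.coeffExt S c)) 2 volume := FunctionSpaces.Torus.memLp_realTrigPoly S _ 2
  have hv : MemLp (FunctionSpaces.Torus.realTrigPoly S (FunctionSpaces.Torus.coeffExt S c) - u) 2 volume := hP.sub hu
  have h1 := FunctionSpaces.Torus.tsum_enorm_sq_mFourierCoeff_complexify hv
  have hcoef : ∀ k, mFourierCoeff (FunctionSpaces.EuclideanSpace.complexify ∘ (FunctionSpaces.Torus.realTrigPoly S (FunctionSpaces.Torus.coeffExt S c) - u)) k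
      = (if k ∈ S then FunctionSpaces.Torus.coeffExt S c k else 0) - mFourierCoeff (FunctionSpaces.EuclideanSpace.complexify ∘ u) k := by
    intro k
    rw [FunctionSpaces.Torus.complexify_comp_sub, FunctionSpaces.Torus.mFourierCoeff_sub (FunctionSpaces.Torus.integrable_complexify_comp
      (hP.integrable one_le_two)) (FunctionSpaces.Torus.integrable_complexify_comp (hu.integrable one_le_two)),
      FunctionSpaces.Torus.mFourierCoeff_realTrigPoly hS (hc.isConjSymm_coeffExt hS)]
  have hfun : (fun x => ‖(FunctionSpaces.Torus.realTrigPoly S (FunctionSpaces.Torus.coeffExt S c) - u) x‖ₑ ^ 2) =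
      fun x => ‖FunctionSpaces.Torus.realTrigPoly S (FunctionSpaces.Torus.coeffExt S c) x - u x‖ₑ ^ 2 := rfl
  rw [hfun] at h1
  rw [← h1, ← ENNReal.sum_add_tsum_compl S, ← Finset.sum_coe_sort]
  congr 1
  · refine Finset.sum_congr rfl fun k _ => ?_
    rw [hcoef, if_pos k.2, FunctionSpaces.Torus.coeffExt_of_mem c k.2]
  · refine tsum_congr fun k => ?_
    have hk : (k : d → ℤ) ∉ S := fun h => k.2 h
    rw [hcoef, if_neg hk, zero_sub, enorm_neg]

end Slices

/-! ## The approximation theorem -/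

section Approx

variable [DecidableEq d] {f : ℝ → UnitAddTorus d → EuclideanSpace ℝ d}

omit [DecidableEq d] in
/-- The vector of Fourier coefficients of a slice on a frequency set, and its `L²(0, n)`
membership: `∫₀ⁿ ‖(f̂(t, k))_{k∈S}‖²_∞ dt ≤ ∫₀ⁿ ∫ ‖f‖² < ⊤`. [folklore] -/
theorem memLp_indicator_mFourierCoeff_slice
    (hf : AEStronglyMeasurable (FunctionSpaces.Torus.stLift f) (volume.restrict (Ioi 0 ×ˢ univ)))
    (hf₂ : ∀ T, 0 < T → ∫⁻ t in Ioo 0 T, ∫⁻ x, ‖f t x‖ₑ ^ 2 < ⊤) (S : Finset (d → ℤ)) (T : ℝ) :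
    MemLp (indicator (Ioo 0 T) fun t (k : ↥S) =>
      mFourierCoeff (FunctionSpaces.EuclideanSpace.complexify ∘ f t) k) 2 volume := by
  set F : ℝ → ↥S → EuclideanSpace ℂ d := fun t k => mFourierCoeff (FunctionSpaces.EuclideanSpace.complexify ∘ f t) k
    with hF
  -- measurability on `(0, T)`
  have hmeas : AEStronglyMeasurable F (volume.restrict (Ioo 0 T)) := by
    rw [aestronglyMeasurable_iff_aemeasurable, aemeasurable_pi_iff]
    intro k
    exact (FunctionSpaces.Torus.aestronglyMeasurable_mFourierCoeff_stSlice hf T k).aemeasurable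
  refine ⟨(aestronglyMeasurable_indicator_iff measurableSet_Ioo).2 hmeas, ?_⟩
  rw [eLpNorm_indicator_eq_eLpNorm_restrict measurableSet_Ioo,
    eLpNorm_lt_top_iff_lintegral_rpow_enorm_lt_top two_ne_zero ENNReal.ofNat_ne_top]
  simp only [ENNReal.toReal_ofNat, ENNReal.rpow_two]
  by_cases hT : 0 < T
  · -- pointwise a.e. bound by the slice energy
    have hbound : ∀ᵐ t ∂(volume.restrict (Ioo 0 T)), ‖F t‖ₑ ^ 2 ≤ ∫⁻ x, ‖f t x‖ₑ ^ 2 := by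
      filter_upwards [FunctionSpaces.Torus.ae_memLp_slice hf (hf₂ T hT)] with t ht
      calc ‖F t‖ₑ ^ 2 ≤ ∑ k : ↥S, ‖F t k‖ₑ ^ 2 := FunctionSpaces.Torus.enorm_sq_le_sum_enorm_sq (F t)
        _ = ∑ k ∈ S, ‖mFourierCoeff (FunctionSpaces.EuclideanSpace.complexify ∘ f t) k‖ₑ ^ 2 := by
            simp only [hF]
            exact Finset.sum_coe_sort S (fun k => ‖mFourierCoeff (FunctionSpaces.EuclideanSpace.complexify ∘ f t) k‖ₑ ^ 2)
        _ ≤ ∑' k, ‖mFourierCoeff (FunctionSpaces.EuclideanSpace.complexify ∘ f t) k‖ₑ ^ 2 :=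
            ENNReal.sum_le_tsum _
        _ = ∫⁻ x, ‖f t x‖ₑ ^ 2 := FunctionSpaces.Torus.tsum_enorm_sq_mFourierCoeff_complexify ht
    exact (lintegral_mono_ae hbound).trans_lt (hf₂ T hT)
  · rw [Ioo_eq_empty hT, Measure.restrict_empty, lintegral_zero_measure]
    exact ENNReal.zero_lt_top

/-- **Approximation of an `L²ₜL²ₓ` field by smooth-in-time real trigonometric polynomials**
(the density step behind the smoothed Galerkin forces; Constantin–Foias 1988, Ch. 8, p. 43 with
(8.3); Robinson–Rodrigo–Sadowski 2016, Lemma 4.1 and p. 74 for the truncation). Let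
`f : ℝ → T^d → ℝ^d` have an a.e.-strongly measurable space–time lift on `(0, ∞) × ℝ^d` and
`∫₀ᵀ ∫ ‖f‖² < ⊤` for every `T > 0`. Then there are coefficient curves
`g n : ℝ → (freqBall n → ℂ^d)`, smooth (`C^∞`) and real (conjugate symmetric) for every `n`,
such that `∫₀ᵀ ∫ ‖realTrigPoly (freqBall n) (g n t) - f t‖² → 0` as `n → ∞` for every
`T > 0`. [cite: ConstantinFoias1988, Ch. 8 (8.3) p. 43] -/
theorem exists_smooth_realTrigPoly_approx
    (hf : AEStronglyMeasurable (FunctionSpaces.Torus.stLift f) (volume.restrict (Ioi 0 ×ˢ univ)))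
    (hf₂ : ∀ T, 0 < T → ∫⁻ t in Ioo 0 T, ∫⁻ x, ‖f t x‖ₑ ^ 2 < ⊤) :
    ∃ g : (n : ℕ) → ℝ → (↥(FunctionSpaces.Torus.freqBall (d := d) n) → EuclideanSpace ℂ d),
      (∀ n, ContDiff ℝ ((⊤ : ℕ∞) : WithTop ℕ∞) (g n)) ∧ (∀ n t, FunctionSpaces.Torus.IsRealCoeff (g n t)) ∧
      ∀ T, 0 < T → Tendsto (fun n => ∫⁻ t in Ioo 0 T,
        ∫⁻ x, ‖FunctionSpaces.Torus.realTrigPoly (FunctionSpaces.Torus.freqBall n) (FunctionSpaces.Torus.coeffExt (FunctionSpaces.Torus.freqBall n) (g n t)) x - f t x‖ₑ ^ 2)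
        atTop (𝓝 0) := by
  -- notation: Fourier coefficients of the slices, restricted to the balls
  set fhat : (k : d → ℤ) → ℝ → EuclideanSpace ℂ d :=
    fun k t => mFourierCoeff (FunctionSpaces.EuclideanSpace.complexify ∘ f t) k with hfhat
  set H : (n : ℕ) → ℝ → ↥(FunctionSpaces.Torus.freqBall (d := d) n) → EuclideanSpace ℂ d :=
    fun n => indicator (Ioo 0 n) fun t k => fhat k t with hH
  have hHmem : ∀ n : ℕ, MemLp (H n) 2 volume := fun n =>
    memLp_indicator_mFourierCoeff_slice hf hf₂ (FunctionSpaces.Torus.freqBall n) n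
  -- the accuracy at stage `n`
  set δ : ℕ → ℝ := fun n => 1 / (((n : ℝ) + 1) * ((FunctionSpaces.Torus.freqBall (d := d) n).card + 1)) with hδ
  have hδpos : ∀ n, 0 < δ n := fun n => by rw [hδ]; positivity
  -- smooth `L²(ℝ)`-approximation of the coefficient curves
  have key : ∀ n : ℕ, ∃ G : ℝ → ↥(FunctionSpaces.Torus.freqBall (d := d) n) → EuclideanSpace ℂ d,
      ContDiff ℝ ((⊤ : ℕ∞) : WithTop ℕ∞) G ∧ eLpNorm (H n - G) 2 volume ≤ ENNReal.ofReal (δ n) := by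
    intro n
    obtain ⟨G, -, hG, hHG⟩ := (hHmem n).exist_eLpNorm_sub_le (by norm_num) (by norm_num) (hδpos n)
    exact ⟨G, hG, hHG⟩
  choose G hGsmooth hGerr using key
  have hS : ∀ n : ℕ, ∀ k ∈ FunctionSpaces.Torus.freqBall (d := d) n, -k ∈ FunctionSpaces.Torus.freqBall n := fun n => FunctionSpaces.Torus.neg_mem_freqBall_of_mem
  -- the real (symmetrised) coefficient curves
  refine ⟨fun n t => FunctionSpaces.Torus.symmetrise (hS n) (G n t), fun n => FunctionSpaces.Torus.ContDiff.symmetrise (hS n) (hGsmooth n),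
    fun n t => FunctionSpaces.Torus.isRealCoeff_symmetrise (hS n) (G n t), fun T hT => ?_⟩
  -- abbreviations for the two error terms
  set A : ℕ → ℝ → ℝ≥0∞ := fun n t => ((FunctionSpaces.Torus.freqBall (d := d) n).card : ℝ≥0∞) * ‖(H n - G n) t‖ₑ ^ 2
    with hA
  set B : ℕ → ℝ → ℝ≥0∞ := fun n t =>
    ∑' k : ↥((FunctionSpaces.Torus.freqBall (d := d) n : Set (d → ℤ))ᶜ), ‖fhat k t‖ₑ ^ 2 with hB
  have hslice := FunctionSpaces.Torus.ae_memLp_slice hf (hf₂ T hT)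
  -- (1) pointwise a.e. bound on `(0, T)` for `n ≥ T`
  have hpt : ∀ n : ℕ, T ≤ n → ∀ᵐ t ∂(volume.restrict (Ioo 0 T)),
      ∫⁻ x, ‖FunctionSpaces.Torus.realTrigPoly (FunctionSpaces.Torus.freqBall n) (FunctionSpaces.Torus.coeffExt (FunctionSpaces.Torus.freqBall n) (FunctionSpaces.Torus.symmetrise (hS n) (G n t))) x -
        f t x‖ₑ ^ 2 ≤ A n t + B n t := by
    intro n hn
    filter_upwards [hslice, ae_restrict_mem measurableSet_Ioo] with t ht htmem
    have htn : t ∈ Ioo (0 : ℝ) n := ⟨htmem.1, htmem.2.trans_le hn⟩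
    rw [lintegral_enorm_sq_realTrigPoly_sub (hS n) (FunctionSpaces.Torus.isRealCoeff_symmetrise (hS n) _) ht]
    refine add_le_add ?_ le_rfl
    -- the low modes: `∑_k ‖sym(G) k - f̂ k‖² ≤ #S ‖G - f̂‖²_∞`
    have hreal : FunctionSpaces.Torus.IsRealCoeff (S := FunctionSpaces.Torus.freqBall n) fun k : ↥(FunctionSpaces.Torus.freqBall (d := d) n) => fhat (k : d → ℤ) t :=
      FunctionSpaces.Torus.isRealCoeff_mFourierCoeff (ht.integrable one_le_two)
    have hHt : H n t = fun k : ↥(FunctionSpaces.Torus.freqBall (d := d) n) => fhat (k : d → ℤ) t := by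
      simp only [hH, indicator_of_mem htn]
    have hcoord : ∀ k : ↥(FunctionSpaces.Torus.freqBall (d := d) n),
        ‖FunctionSpaces.Torus.symmetrise (hS n) (G n t) k - fhat k t‖ₑ ^ 2 ≤ ‖(H n - G n) t‖ₑ ^ 2 := by
      intro k
      have h1 : FunctionSpaces.Torus.symmetrise (hS n) (G n t) k - fhat k t =
          FunctionSpaces.Torus.symmetrise (hS n) (G n t - H n t) k := by
        rw [FunctionSpaces.Torus.symmetrise_sub, Pi.sub_apply, hHt, FunctionSpaces.Torus.symmetrise_of_isRealCoeff (hS n) hreal]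
      rw [h1]
      gcongr
      rw [← ofReal_norm, ← ofReal_norm]
      refine ENNReal.ofReal_le_ofReal ((FunctionSpaces.Torus.norm_symmetrise_apply_le (hS n) _ k).trans (le_of_eq ?_))
      rw [Pi.sub_apply, norm_sub_rev]
    calc ∑ k : ↥(FunctionSpaces.Torus.freqBall (d := d) n), ‖FunctionSpaces.Torus.symmetrise (hS n) (G n t) k - fhat k t‖ₑ ^ 2
        ≤ ∑ _k : ↥(FunctionSpaces.Torus.freqBall (d := d) n), ‖(H n - G n) t‖ₑ ^ 2 :=
          Finset.sum_le_sum fun k _ => hcoord k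
      _ = A n t := by simp [hA]
  -- (2) the low-mode error integrates to at most `1/(n+1)`
  have hAint : ∀ n : ℕ, ∫⁻ t in Ioo 0 T, A n t ≤ ENNReal.ofReal (1 / ((n : ℝ) + 1)) := by
    intro n
    have h1 : ∫⁻ t in Ioo 0 T, A n t ≤ ((FunctionSpaces.Torus.freqBall (d := d) n).card : ℝ≥0∞) *
        ∫⁻ t, ‖(H n - G n) t‖ₑ ^ 2 := by
      rw [hA]
      simp only
      rw [lintegral_const_mul' _ _ (ENNReal.natCast_ne_top _)]
      gcongr
      exact Measure.restrict_le_self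
    have h2 : ∫⁻ t, ‖(H n - G n) t‖ₑ ^ 2 = eLpNorm (H n - G n) 2 volume ^ 2 := by
      rw [eLpNorm_eq_lintegral_rpow_enorm_toReal two_ne_zero ENNReal.ofNat_ne_top]
      simp only [ENNReal.toReal_ofNat, ENNReal.rpow_two, ENNReal.rpow_half_sq]
    refine h1.trans ?_
    rw [h2]
    calc ((FunctionSpaces.Torus.freqBall (d := d) n).card : ℝ≥0∞) * eLpNorm (H n - G n) 2 volume ^ 2
        ≤ ((FunctionSpaces.Torus.freqBall (d := d) n).card : ℝ≥0∞) * ENNReal.ofReal (δ n) ^ 2 := by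
          gcongr; exact hGerr n
      _ = ENNReal.ofReal ((FunctionSpaces.Torus.freqBall (d := d) n).card * δ n ^ 2) := by
          rw [ENNReal.ofReal_mul (by positivity), ENNReal.ofReal_natCast,
            ENNReal.ofReal_pow (hδpos n).le]
      _ ≤ ENNReal.ofReal (1 / ((n : ℝ) + 1)) := by
          refine ENNReal.ofReal_le_ofReal ?_
          rw [hδ]
          simp only
          set c : ℝ := ((FunctionSpaces.Torus.freqBall (d := d) n).card : ℝ) with hc
          have hc0 : 0 ≤ c := by positivity
          have hn0 : (0 : ℝ) < (n : ℝ) + 1 := by positivity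
          rw [div_pow, one_pow, mul_pow, mul_one_div, div_le_div_iff₀ (by positivity) hn0, one_mul]
          nlinarith [sq_nonneg c, mul_nonneg hc0 hn0.le]
  -- (3) the tails integrate to zero in the limit (dominated convergence)
  have hBmeas : ∀ n, AEMeasurable (B n) (volume.restrict (Ioo 0 T)) := by
    intro n
    refine AEMeasurable.tsum fun k => ?_
    exact ((FunctionSpaces.Torus.aestronglyMeasurable_mFourierCoeff_stSlice hf T (k : d → ℤ)).enorm.pow_const 2)
  have hBle : ∀ n, B n ≤ᵐ[volume.restrict (Ioo 0 T)] fun t => ∫⁻ x, ‖f t x‖ₑ ^ 2 := by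
    intro n
    filter_upwards [hslice] with t ht
    rw [← FunctionSpaces.Torus.tsum_enorm_sq_mFourierCoeff_complexify ht]
    exact ENNReal.tsum_comp_le_tsum_of_injective Subtype.val_injective
      (fun k => ‖fhat k t‖ₑ ^ 2)
  have hBlim : ∀ᵐ t ∂(volume.restrict (Ioo 0 T)), Tendsto (fun n => B n t) atTop (𝓝 0) := by
    filter_upwards [hslice] with t ht
    have hfin : ∑' k, ‖fhat k t‖ₑ ^ 2 ≠ ⊤ := by
      have h1 : ∑' k, ‖fhat k t‖ₑ ^ 2 = ∫⁻ x, ‖f t x‖ₑ ^ 2 :=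
        FunctionSpaces.Torus.tsum_enorm_sq_mFourierCoeff_complexify ht
      have h2 : ∫⁻ x, ‖f t x‖ₑ ^ 2 < ⊤ := by
        have := (eLpNorm_lt_top_iff_lintegral_rpow_enorm_lt_top two_ne_zero
          ENNReal.ofNat_ne_top).1 ht.eLpNorm_lt_top
        simpa only [ENNReal.toReal_ofNat, ENNReal.rpow_two] using this
      exact ne_top_of_le_ne_top h2.ne h1.le
    exact (ENNReal.tendsto_tsum_compl_atTop_zero hfin).comp FunctionSpaces.Torus.tendsto_freqBall_atTop
  have hBint : Tendsto (fun n => ∫⁻ t in Ioo 0 T, B n t) atTop (𝓝 0) := by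
    have h := tendsto_lintegral_of_dominated_convergence' (fun t => ∫⁻ x, ‖f t x‖ₑ ^ 2) hBmeas
      hBle (hf₂ T hT).ne hBlim
    simpa only [lintegral_zero] using h
  -- (4) squeeze
  have hupper : Tendsto (fun n : ℕ => ENNReal.ofReal (1 / ((n : ℝ) + 1)) + ∫⁻ t in Ioo 0 T, B n t)
      atTop (𝓝 0) := by
    have h1 : Tendsto (fun n : ℕ => ENNReal.ofReal (1 / ((n : ℝ) + 1))) atTop (𝓝 0) := by
      have := ENNReal.tendsto_ofReal (tendsto_one_div_add_atTop_nhds_zero_nat (𝕜 := ℝ))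
      simpa only [ENNReal.ofReal_zero] using this
    simpa only [add_zero] using h1.add hBint
  refine tendsto_of_tendsto_of_tendsto_of_le_of_le' tendsto_const_nhds hupper
    (Eventually.of_forall fun _ => zero_le) ?_
  filter_upwards [eventually_ge_atTop ⌈T⌉₊] with n hn
  have hTn : T ≤ n := (Nat.le_ceil T).trans (by exact_mod_cast hn)
  calc ∫⁻ t in Ioo 0 T, ∫⁻ x, ‖FunctionSpaces.Torus.realTrigPoly (FunctionSpaces.Torus.freqBall n)
        (FunctionSpaces.Torus.coeffExt (FunctionSpaces.Torus.freqBall n) (FunctionSpaces.Torus.symmetrise (hS n) (G n t))) x - f t x‖ₑ ^ 2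
      ≤ ∫⁻ t in Ioo 0 T, (A n t + B n t) := lintegral_mono_ae (hpt n hTn)
    _ = (∫⁻ t in Ioo 0 T, A n t) + ∫⁻ t in Ioo 0 T, B n t := lintegral_add_right' _ (hBmeas n)
    _ ≤ ENNReal.ofReal (1 / ((n : ℝ) + 1)) + ∫⁻ t in Ioo 0 T, B n t :=
        add_le_add (hAint n) le_rfl

omit [DecidableEq d] in
/-- **Smoothness of the space–time lift of a trigonometric polynomial with smooth coefficient
curve**: `(t, y) ↦ realTrigPoly S (g t) (proj y)` is `C^∞` on `ℝ × ℝ^d` when `g` is. [folklore] -/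
theorem contDiff_stLift_realTrigPoly {S : Finset (d → ℤ)} {g : ℝ → ↥S → EuclideanSpace ℂ d}
    (hg : ContDiff ℝ ((⊤ : ℕ∞) : WithTop ℕ∞) g) :
    ContDiff ℝ ((⊤ : ℕ∞) : WithTop ℕ∞) (FunctionSpaces.Torus.stLift fun t => FunctionSpaces.Torus.realTrigPoly S (FunctionSpaces.Torus.coeffExt S (g t))) := by
  have h : FunctionSpaces.Torus.stLift (fun t => FunctionSpaces.Torus.realTrigPoly S (FunctionSpaces.Torus.coeffExt S (g t))) = fun p : ℝ × EuclideanSpace ℝ d =>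
      FunctionSpaces.EuclideanSpace.realPart (∑ k ∈ S, mFourier k (FunctionSpaces.Torus.proj p.2) • FunctionSpaces.Torus.coeffExt S (g p.1) k) := by
    funext p
    rw [FunctionSpaces.Torus.stLift_apply, FunctionSpaces.Torus.realTrigPoly_apply, FunctionSpaces.Torus.trigPoly_apply]
  rw [h]
  refine (FunctionSpaces.EuclideanSpace.realPart (ι := d)).contDiff.comp ?_
  refine ContDiff.sum fun k hk => ?_
  have h1 : ContDiff ℝ ((⊤ : ℕ∞) : WithTop ℕ∞) fun p : ℝ × EuclideanSpace ℝ d => mFourier k (FunctionSpaces.Torus.proj p.2) :=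
    (FunctionSpaces.Torus.isSmooth_mFourier k).comp contDiff_snd
  have h2 : ContDiff ℝ ((⊤ : ℕ∞) : WithTop ℕ∞) fun p : ℝ × EuclideanSpace ℝ d => FunctionSpaces.Torus.coeffExt S (g p.1) k := by
    simp_rw [FunctionSpaces.Torus.coeffExt_of_mem _ hk]
    exact (contDiff_pi.1 hg ⟨k, hk⟩).comp contDiff_fst
  exact h1.smul h2

end Approx

end Torus

end Literature.Analysis.FluidPDE

/-!
# Part 3 — assembly: the Galerkin approximations exist
  (discharge of `NS.hopf_galerkin_scheme_exists`)

Trunk: FluidKinetic. `Literature/Analysis/FluidPDE/NSHopfGalerkin` decomposes the named fact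
`NS.hopf_existence_torus` (Hopf 1951) into `NS.hopf_galerkin_scheme_exists` (Step 1–2 of the
printed proof: the Fourier–Galerkin approximations exist globally and satisfy the tested
Galerkin equations and the energy identity; Robinson–Rodrigo–Sadowski 2016, Thm. 4.4, Steps 1–2;
Constantin–Foias 1988, Ch. 8, (8.3)–(8.16); Hopf 1951, §§2–3) and `NS.hopf_galerkin_limit`
(Steps 3–4, the compactness argument). This file **proves the first half** by assembling

* the smoothed forces `F n = realTrigPoly (freqBall n) (g n t) → f` in `L²((0,T) × T^d)`
  (`Torus.exists_smooth_realTrigPoly_approx`, `TorusForceApprox`),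
* the global solutions of the Galerkin ODE in the real divergence-free coefficient vectors, with
  the tested Galerkin identity and the energy identity (`NS.exists_galerkin_solution`,
  `NS.galerkin_test_identity`, `NS.galerkin_energy_identity`, `NSGalerkinODE`),
* the datum `U n 0 = P_n u₀` (`Torus.fourierTruncate`, `TorusTrigPoly`),

into `NS.IsHopfGalerkinScheme ν f u₀ id F U` in every dimension
(`NS.exists_isHopfGalerkinScheme`), whence `NS.hopf_galerkin_scheme_exists_holds` on `𝕋³`.

## References

* E. Hopf, *Über die Anfangswertaufgabe für die hydrodynamischen Grundgleichungen*, Math. Nachr.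
  4 (1951), 213–231, §§2–3.
* J. C. Robinson, J. L. Rodrigo, W. Sadowski, *The three-dimensional Navier–Stokes equations*
  (CUP 2016), §4.1, Thm. 4.4, Steps 1–2, (4.2)–(4.8), Lemma 4.1.
* P. Constantin, C. Foias, *Navier–Stokes Equations* (Chicago 1988), Ch. 8, (8.3)–(8.16), p. 43.
-/

open MeasureTheory Set Filter Topology UnitAddTorus
open scoped ENNReal NNReal InnerProductSpace

namespace Literature.Analysis.FluidPDE

open FunctionSpaces.Torus Torus

/-! ### The scheme in every dimension -/

section General

variable {d : Type*} [Fintype d] [DecidableEq d]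

/-- **Existence of a Hopf–Galerkin scheme** in every dimension (Robinson–Rodrigo–Sadowski 2016,
Thm. 4.4, Steps 1–2; Constantin–Foias 1988, Ch. 8, (8.3)–(8.9), p. 43; Hopf 1951, §§2–3). Let
`ν > 0`, `u₀ ∈ L²(T^d; ℝ^d)` weakly divergence free, and `f` space–time measurable with
`∫₀ᵀ ∫ ‖f‖² < ∞` for every `T > 0`. With `N n = n`, smoothed forces
`F n = realTrigPoly (freqBall n) (g n ·)` (`Torus.exists_smooth_realTrigPoly_approx`) and
`U n = realTrigPoly (freqBall n) (α n ·)`, `α n` the global solution of the `n`-th Galerkin ODE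
from the datum `(û₀(k))_{|k| ≤ n}` (`NS.exists_galerkin_solution`), the triple `(N, F, U)` is a
Hopf–Galerkin scheme for `(ν, f, u₀)`. [cite: RobinsonRodrigoSadowski2016, Thm. 4.4 Steps 1–2] -/
theorem exists_isHopfGalerkinScheme (ν : ℝ) (hν : 0 < ν)
    (u₀ : UnitAddTorus d → EuclideanSpace ℝ d) (hu₀ : MemLp u₀ 2 volume)
    (hdiv : FunctionSpaces.Torus.IsWeaklyDivFree u₀) (f : ℝ → UnitAddTorus d → EuclideanSpace ℝ d)
    (hf : AEStronglyMeasurable (stLift f) (volume.restrict (Ioi 0 ×ˢ univ)))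
    (hf₂ : ∀ T, 0 < T → ∫⁻ t in Ioo 0 T, ∫⁻ x, ‖f t x‖ₑ ^ 2 < ⊤) :
    ∃ (N : ℕ → ℕ) (F U : ℕ → ℝ → UnitAddTorus d → EuclideanSpace ℝ d),
      IsHopfGalerkinScheme ν f u₀ N F U := by
  -- the smoothed forces
  obtain ⟨g, hg_smooth, hg_real, hg_tend⟩ := exists_smooth_realTrigPoly_approx hf hf₂
  have hg_cont : ∀ n, Continuous (g n) := fun n => (hg_smooth n).continuous
  have hS : ∀ n : ℕ, ∀ k ∈ freqBall (d := d) n, -k ∈ freqBall n := fun n =>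
    neg_mem_freqBall_of_mem
  -- the data of the Galerkin systems: `(û₀(k))_{|k| ≤ n}`
  set c₀ : (n : ℕ) → ↥(freqBall (d := d) n) → EuclideanSpace ℂ d :=
    fun n k => mFourierCoeff (FunctionSpaces.EuclideanSpace.complexify ∘ u₀) k with hc₀_def
  have hc₀ : ∀ n, c₀ n ∈ galerkinSubspace (freqBall (d := d) n) := fun n =>
    ⟨isRealCoeff_mFourierCoeff (hu₀.integrable one_le_two),
      isSolenoidalCoeff_restrict (hdiv.isTransversal_mFourierCoeff hu₀ (freqBall n))⟩
  -- the global Galerkin solutions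
  have hsol : ∀ n : ℕ, ∃ α : ℝ → ↥(freqBall (d := d) n) → EuclideanSpace ℂ d,
      α 0 = c₀ n ∧ (∀ t, α t ∈ galerkinSubspace (freqBall n)) ∧ ContinuousOn α (Ici 0) ∧
      ∀ T, ∀ t ∈ Icc 0 T, HasDerivWithinAt α (galerkinRHS (freqBall n) ν (g n t) (α t))
        (Icc 0 T) t := fun n =>
    exists_galerkin_solution ν hν.le (hS n) (hg_cont n) (hg_real n) (hc₀ n)
  choose α hα0 hαmem hαcont hαderiv using hsol
  -- the scheme
  refine ⟨id, fun n t => realTrigPoly (freqBall n) (coeffExt (freqBall n) (g n t)),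
    fun n t => realTrigPoly (freqBall n) (coeffExt (freqBall n) (α n t)), ?_⟩
  -- the datum is the Fourier truncation
  have hU0 : ∀ n, realTrigPoly (freqBall n) (coeffExt (freqBall n) (α n 0)) =
      fourierTruncate n u₀ := by
    intro n
    rw [hα0 n, fourierTruncate_eq]
    exact realTrigPoly_coeffExt_restrict _
  -- band-limitation of Galerkin modes in `Finset` form
  have hband : ∀ {n : ℕ} {a : UnitAddTorus d → EuclideanSpace ℝ d}, IsGalerkinMode n a →
      ∀ k ∉ freqBall (d := d) n, mFourierCoeff (FunctionSpaces.EuclideanSpace.complexify ∘ a) k = 0 :=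
    fun ha k hk => ha.mFourierCoeff_eq_zero (not_mem_freqBall.1 hk)
  exact
    { tendsto_order := tendsto_id
      smooth_force := fun n => contDiff_stLift_realTrigPoly (hg_smooth n)
      tendsto_force := hg_tend
      continuousOn := fun n => continuousOn_stLift_realTrigPoly (hαcont n)
      isGalerkinMode := fun n t _ =>
        have h := galerkin_slice_props (hS n) (hαmem n t)
        ⟨h.1, h.2.1, fun k hk => h.2.2.2 k (not_mem_freqBall.2 hk)⟩
      isWeaklyDivFree := fun n t _ => (galerkin_slice_props (hS n) (hαmem n t)).2.2.1
      galerkin := fun n a ha s t hs hst =>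
        galerkin_test_identity ν (hS n) (hg_cont n) (hg_real n) (hαmem n) (hαderiv n)
          ha.isSmooth ha.isDivFree (hband ha) hs hst
      energy_eq := fun n s t hs hst =>
        galerkin_energy_identity ν (hS n) (hg_cont n) (hg_real n) (hαmem n) (hαderiv n) hs hst
      initial_inner := fun n a ha => by
        rw [hU0 n]
        exact integral_inner_fourierTruncate_eq hu₀ (ha.isSmooth.memLp 2) (hband ha)
      tendsto_initial := by
        have heq : (fun n => eLpNorm (realTrigPoly (freqBall n) (coeffExt (freqBall n) (α n 0)) -
            u₀) 2 volume) = fun n => eLpNorm (fourierTruncate n u₀ - u₀) 2 volume := by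
          funext n; rw [hU0 n]
        rw [heq]
        exact tendsto_eLpNorm_fourierTruncate_sub hu₀ }

end General

/-! ### The named fact on `𝕋³` -/

/-- **Discharge of `NS.hopf_galerkin_scheme_exists`** (Robinson–Rodrigo–Sadowski 2016, Thm. 4.4,
Steps 1–2; Constantin–Foias 1988, Ch. 8, (8.3)–(8.16); Hopf 1951, §§2–3): every datum/force as
in `NS.hopf_existence_torus` admits a Hopf–Galerkin scheme, by `exists_isHopfGalerkinScheme` in
dimension `3`. [cite: RobinsonRodrigoSadowski2016, Thm. 4.4 Steps 1–2] -/
theorem hopf_galerkin_scheme_exists_holds : hopf_galerkin_scheme_exists :=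
  fun ν hν u₀ hu₀ hdiv f hf hf₂ => exists_isHopfGalerkinScheme ν hν u₀ hu₀ hdiv f hf hf₂

end Literature.Analysis.FluidPDE

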